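import Summits.Ventures.CertifiedQuantumChemistry.Certificates.HubbardRingL6SingletLiftQMapRows0
import Summits.Ventures.CertifiedQuantumChemistry.Certificates.HubbardRingL6SingletLiftQMapRows1
import Summits.Ventures.CertifiedQuantumChemistry.Certificates.HubbardRingL6SingletLiftQMapRows2
import Summits.Ventures.CertifiedQuantumChemistry.Certificates.HubbardRingL6SingletLiftGMapRows0
import Summits.Ventures.CertifiedQuantumChemistry.Certificates.HubbardRingL6SingletLiftGMapRows1
import Summits.Ventures.CertifiedQuantumChemistry.Certificates.HubbardRingL6SingletLiftGMapRows2
import Summits.Ventures.CertifiedQuantumChemistry.Certificates.HubbardRingL6LiftFeasible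
import HarnessLib

/-!
# Ventures/CertifiedQuantumChemistry — Certificates/HubbardRingL6SingletLiftFeasible.lean: LAYER 2 of the L = 6 DQG+S² (singlet) lift assembly —
# the exact singlet lift FAMILY `(γˢ(ε), Γˢ(ε))` of the half-filled Hubbard 6-ring is SINGLET-DQG-feasible (`IsDQGFeasibleSinglet 3`:
# the `(3,3)`-sector rows AND the `S`-representability row (98)) for every `0 < ε ≤ 2⁻⁵¹` — i.e. at every `U = 1/ε ≥ 2⁵¹`

HONEST FRAMING (verbatim): certified bounds for a stated model Hamiltonian in a stated basis; not a
claim about the real molecule beyond that model. Auxiliary objects only; no model energy is bounded in THIS file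
(the energy and the plateau floor are `…L6SingletLiftPlateauFloor.lean`).

Seat rdm-B (gen 43; the DQG+S² twin of `…L6LiftFeasible.lean` of the same gen, whose generic lemmas `sum_orb6`, `cast_qMapP6`,
`cast_gMapP6`, `sum_family6`, `sum_weight_flag0` are REUSED; plan `tools/x14-g42/l6/MEMO-L6-KERNEL-FLOOR.md` §5).
THE OBJECT: the one-parameter family `(γ(ε), Γ(ε)) = Σ_{j ≤ 2} ε^j (γ_j, Γ_j)` (FIELD `ℚ`: no `√2`, no second parameter) of
the EXACT singlet lift `pub-qchem-rdmb/ab-files/v44/lift2_L6_DQG_s2v0.json` (rdm-B gen 24, format `rdmB-exact-lift/2`, the lift of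
the level-DQG programme WITH the `⟨Ŝ²⟩ = 0` row; until now words + exact-certificate grade `liminf_U ĉ_DQG+S²(6;U) ≥ 1.0357214185`), read in the LEAN CONVENTION: `Γˢ_j = LiftL6.l6sGG j` on the 144 ordered-pair codes (signed scatter-sums of
the landed singlet pair-block tables, `…L6SingletLiftPairPSD.lean`), `γˢ_j = LiftL6.l6sGam j` (`…L6SingletLiftCoeffRows.lean`); NO SDP solver anywhere.

WHAT IS PROVED (by LINEARITY from kernel facts already in the tree; this file runs no large `decide`):
* §1 `liftGamC6s ε`, `liftGGC6s ε` — the family as complex matrices on `Orb (Fin 6)` / ordered pairs, with real entries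
  `liftGamR6s`, `liftGGR6s` (read through the codes `eOrb6`, `ePair6`);
* §2 the three POSITIVITY conditions over `ℂ` for `0 < ε ≤ 2⁻⁵¹`: `Γ(ε) ⪰ 0`, `Q ⪰ 0`, `G ⪰ 0` — LAYER 1
  (`l6srealGG_posSemidef`, `l6srealQQ_posSemidef`, `l6srealGm_posSemidef`: all nine symmetry blocks certified along the family by
  `Rows/PencilBlockCertificateRat.lean`) carried to `qMap`/`gMap` OF THE FAMILY through the kernel identities
  `Q_j = qMapP6 (γ_j, Γ_j)`, `G_j = gMapP6 (γ_j, Γ_j)` (`…L6SingletLift{Q,G}MapRows{0,1,2}.lean`) and affinity/linearity of the maps (the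
  `Q`-map's constant rides on the coefficient `j = 0` of weight `ε⁰ = 1`; Kronecker symbols become the real atoms `LiftL4.kd`, so
  each bridge is ONE polynomial identity closed by `ring`), then complexified (`DQGGap.posSemidef_map_ofReal`) and re-indexed;
* §3 every LINEAR row of `IsDQGFeasibleSector 3 3` (Hermiticity, `S_z` selection, traces `3, 3`, contraction onto `5γ`,
  antisymmetries, block traces `6, 6, 9`) AND the singlet row `Σ_{xy} Γˢ(x↑,y↓; y↑,x↓) = 3` from the coefficientwise kernel rows of
  `…L6SingletLiftCoeffRows.lean` by exchanging finite sums; hence **`lift6s_isDQGFeasibleSector`** and **`lift6s_isDQGFeasibleSinglet`**.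
NOT a row of `CERTIFIED.md`, no claim node; S-U UNTOUCHED. 0 sorry; four small `def`s (`liftGamR6s`, `liftGGR6s`, `liftGamC6s`,
`liftGGC6s`), standard axioms. References (docstring-only): D. A. Mazziotti, Adv. Chem. Phys. 134 (2007) ch. 3 §II.B
eqs. (11)–(17), §II.F, §II.F.1 eqs. (96)–(98); M. Nakata et al., J. Chem. Phys. 128 (2008) 164113 §II.C.
-/

set_option linter.style.longLine false

namespace Summit.Ventures.CertifiedQuantumChemistry

namespace LiftL6

open Matrix Finset DQGGap LiftL4
open Literature.MathematicalPhysics.QuantumLattice Literature.MathematicalPhysics.QuantumChemistry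
open scoped ComplexOrder

/-! ## §1 The family as real and complex matrices -/

/-- The real one-matrix family of the singlet lift: `γ(ε)_{xy} = Σ_j ε^j · γ_j(x, y)` (`ε = 1/U`), read through the orbital codes. -/
noncomputable def liftGamR6s (ε : ℝ) (x y : Orb (Fin 6)) : ℝ :=
  ∑ j : Fin 3, ε ^ (j : ℕ) * ((l6sGam j (eOrb6 x) (eOrb6 y) : ℚ) : ℝ)

/-- The real two-matrix family of the singlet lift on ordered pairs: `Γ(ε)_{PR} = Σ_j ε^j · Γ_j(P, R)`, read through the pair codes. -/
noncomputable def liftGGR6s (ε : ℝ) (P R : Orb (Fin 6) × Orb (Fin 6)) : ℝ :=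
  ∑ j : Fin 3, ε ^ (j : ℕ) * ((l6sGG j (ePair6 P) (ePair6 R) : ℚ) : ℝ)

/-- The singlet lift family's one-matrix as a complex matrix (real entries). -/
noncomputable def liftGamC6s (ε : ℝ) : Matrix (Orb (Fin 6)) (Orb (Fin 6)) ℂ :=
  fun x y => ((liftGamR6s ε x y : ℝ) : ℂ)

/-- The singlet lift family's two-matrix as a complex matrix (real entries). -/
noncomputable def liftGGC6s (ε : ℝ) : Matrix (Orb (Fin 6) × Orb (Fin 6)) (Orb (Fin 6) × Orb (Fin 6)) ℂ :=
  fun P R => ((liftGGR6s ε P R : ℝ) : ℂ)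

/-! ## §2 The three positivity conditions along the family (from layer 1) -/

/-- `Γ(ε)` on pairs is the landed `l6srealGG` re-indexed. -/
theorem l6srealGG_ePair (ε : ℝ) (P R : Orb (Fin 6) × Orb (Fin 6)) : l6srealGG ε (ePair6 P) (ePair6 R) = liftGGR6s ε P R := by
  simp only [l6srealGG, liftGGR6s, Matrix.sum_apply, Matrix.smul_apply, Matrix.map_apply, smul_eq_mul]

/-- The complex two-matrix of the family is the complexification of `l6srealGG`, re-indexed to ordered pairs. -/
theorem liftGGC6s_eq (ε : ℝ) : liftGGC6s ε = ((l6srealGG ε).map Complex.ofRealHom).submatrix ePair6 ePair6 := by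
  ext P R
  simp only [liftGGC6s, Matrix.submatrix_apply, Matrix.map_apply, Complex.ofRealHom_eq_coe, l6srealGG_ePair]

/-- **`Q(ε)` is the real `Q`-map of the family** (the kernel identities `Q_j = qMapP6 (γ_j, Γ_j)` and linearity in the
weights `ε^j`; the affine constant rides on the coefficient `j = 0` of weight `1`). -/
theorem l6srealQQ_ePair (ε : ℝ) (P R : Orb (Fin 6) × Orb (Fin 6)) :
    l6srealQQ ε (ePair6 P) (ePair6 R) = qMapR (liftGamR6s ε) (liftGGR6s ε) P R := by
  -- stage 1: expand the coefficient sum and insert the kernel identities `Q_j = qMapP6 (γ_j, Γ_j)`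
  simp only [l6srealQQ, Matrix.sum_apply, Matrix.smul_apply, Matrix.map_apply, smul_eq_mul, Fin.sum_univ_three, Fin.isValue,
    l6sQQ_eq_qMapP0, l6sQQ_eq_qMapP1, l6sQQ_eq_qMapP2]
  -- stage 2: evaluate both sides as polynomials in the Kronecker symbols and the table entries
  simp only [toFin6, Equiv.symm_apply_apply, cast_qMapP6, gamO, GamO, liftGamR6s, liftGGR6s, qMapR, Fin.sum_univ_three,
    Fin.isValue, Fin.val_zero, Fin.val_one, Fin.val_two, pow_zero, pow_one, one_mul, if_true, Bool.false_eq_true,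
    if_false, zero_sub]
  -- stage 3: Kronecker symbols as real atoms; one polynomial identity
  simp only [ite_and, ite_eq_kd_mul]
  ring

/-- **`G(ε)` is the real `G`-map of the family** (kernel identities `G_j = gMapP6 (γ_j, Γ_j)`, linearity). -/
theorem l6srealGm_ePair (ε : ℝ) (P R : Orb (Fin 6) × Orb (Fin 6)) :
    l6srealGm ε (ePair6 P) (ePair6 R) = gMapR (liftGamR6s ε) (liftGGR6s ε) P R := by
  simp only [l6srealGm, Matrix.sum_apply, Matrix.smul_apply, Matrix.map_apply, smul_eq_mul, Fin.sum_univ_three, Fin.isValue,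
    l6sGm_eq_gMapP0, l6sGm_eq_gMapP1, l6sGm_eq_gMapP2]
  simp only [toFin6, Equiv.symm_apply_apply, cast_gMapP6, gamO, GamO, liftGamR6s, liftGGR6s, gMapR, Fin.sum_univ_three,
    Fin.isValue, Fin.val_zero, Fin.val_one, Fin.val_two, pow_zero, pow_one, one_mul]
  simp only [ite_eq_kd_mul]
  ring

/-- The `Q`-matrix of the complex family is the complexification of `l6srealQQ`, re-indexed. -/
theorem qMap_liftC6s_eq (ε : ℝ) :
    qMap (liftGamC6s ε) (liftGGC6s ε) = ((l6srealQQ ε).map Complex.ofRealHom).submatrix ePair6 ePair6 := by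
  change qMap (fun i j => ((liftGamR6s ε i j : ℝ) : ℂ)) (fun P R => ((liftGGR6s ε P R : ℝ) : ℂ)) = _
  rw [qMap_ofReal]
  ext P R
  simp only [Matrix.submatrix_apply, Matrix.map_apply, Complex.ofRealHom_eq_coe, l6srealQQ_ePair]

/-- The `G`-matrix of the complex family is the complexification of `l6srealGm`, re-indexed. -/
theorem gMap_liftC6s_eq (ε : ℝ) :
    gMap (liftGamC6s ε) (liftGGC6s ε) = ((l6srealGm ε).map Complex.ofRealHom).submatrix ePair6 ePair6 := by
  change gMap (fun i j => ((liftGamR6s ε i j : ℝ) : ℂ)) (fun P R => ((liftGGR6s ε P R : ℝ) : ℂ)) = _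
  rw [gMap_ofReal]
  ext P R
  simp only [Matrix.submatrix_apply, Matrix.map_apply, Complex.ofRealHom_eq_coe, l6srealGm_ePair]

/-- **D-condition of the family**: `Γ(ε) ⪰ 0` over `ℂ` for `0 < ε ≤ 2⁻⁵¹`. -/
theorem liftGGC6s_posSemidef {ε : ℝ} (hε0 : 0 < ε) (hε1 : ε ≤ 1 / 2 ^ 51) : (liftGGC6s ε).PosSemidef := by
  rw [liftGGC6s_eq]
  exact (posSemidef_map_ofReal (l6srealGG_posSemidef hε0 hε1)).submatrix ePair6

/-- **Q-condition of the family**: `Q(γ(ε), Γ(ε)) ⪰ 0` over `ℂ` for `0 < ε ≤ 2⁻⁵¹`. -/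
theorem qMap_liftC6s_posSemidef {ε : ℝ} (hε0 : 0 < ε) (hε1 : ε ≤ 1 / 2 ^ 51) :
    (qMap (liftGamC6s ε) (liftGGC6s ε)).PosSemidef := by
  rw [qMap_liftC6s_eq]
  exact (posSemidef_map_ofReal (l6srealQQ_posSemidef hε0 hε1)).submatrix ePair6

/-- **G-condition of the family**: `G(γ(ε), Γ(ε)) ⪰ 0` over `ℂ` for `0 < ε ≤ 2⁻⁵¹`. -/
theorem gMap_liftC6s_posSemidef {ε : ℝ} (hε0 : 0 < ε) (hε1 : ε ≤ 1 / 2 ^ 51) :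
    (gMap (liftGamC6s ε) (liftGGC6s ε)).PosSemidef := by
  rw [gMap_liftC6s_eq]
  exact (posSemidef_map_ofReal (l6srealGm_posSemidef hε0 hε1)).submatrix ePair6

/-! ## §3 The linear rows along the family (from the coefficientwise kernel facts, by linearity) -/

/-- Entries of the real one-matrix family at orbitals. -/
theorem liftGamR6s_orb (ε : ℝ) (p : Fin 6) (σ : Fin 2) (q : Fin 6) (τ : Fin 2) :
    liftGamR6s ε (orb p σ) (orb q τ) = ∑ j : Fin 3, ε ^ (j : ℕ) * ((l6sGam j (eOrb6 (orb p σ)) (eOrb6 (orb q τ)) : ℚ) : ℝ) :=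
  rfl

/-- Entries of the real two-matrix family at orbital pairs. -/
theorem liftGGR6s_orb (ε : ℝ) (a b c d : Orb (Fin 6)) :
    liftGGR6s ε (a, b) (c, d) = ∑ j : Fin 3, ε ^ (j : ℕ) * ((l6sGG j (ePair6 (a, b)) (ePair6 (c, d)) : ℚ) : ℝ) :=
  rfl

/-- The real one-matrix family is symmetric. -/
theorem liftGamR6s_symm (ε : ℝ) (p : Fin 6) (σ : Fin 2) (q : Fin 6) (τ : Fin 2) :
    liftGamR6s ε (orb q τ) (orb p σ) = liftGamR6s ε (orb p σ) (orb q τ) := by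
  rw [liftGamR6s_orb, liftGamR6s_orb]
  refine Finset.sum_congr rfl fun j _ => ?_
  rw [(l6sGam_rows j).1 p q σ τ]

/-- `S_z` selection rule of the one-matrix family. -/
theorem liftGamR6s_spin (ε : ℝ) (p q : Fin 6) {σ τ : Fin 2} (h : σ ≠ τ) : liftGamR6s ε (orb p σ) (orb q τ) = 0 := by
  rw [liftGamR6s_orb]
  refine Finset.sum_eq_zero fun j _ => ?_
  rw [(l6sGam_rows j).2.1 p q σ τ h, Rat.cast_zero, mul_zero]

/-- Spin-up trace of the one-matrix family: `3`. -/
theorem liftGamR6s_trace_up (ε : ℝ) : ∑ x : Fin 6, liftGamR6s ε (orb x 0) (orb x 0) = 3 := by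
  simp only [liftGamR6s_orb]
  rw [sum_family6]
  simp only [fun j => (l6sGam_rows j).2.2.1, sum_weight_flag0, Rat.cast_ofNat]

/-- Spin-down trace of the one-matrix family: `3`. -/
theorem liftGamR6s_trace_down (ε : ℝ) : ∑ x : Fin 6, liftGamR6s ε (orb x 1) (orb x 1) = 3 := by
  simp only [liftGamR6s_orb]
  rw [sum_family6]
  simp only [fun j => (l6sGam_rows j).2.2.2, sum_weight_flag0, Rat.cast_ofNat]

/-- Contraction row of the two-matrix family: `Σ_{rμ} Γ(pσ rμ; qτ rμ) = 5·γ(pσ; qτ)`. -/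
theorem liftGGR6s_contract (ε : ℝ) (p : Fin 6) (σ : Fin 2) (q : Fin 6) (τ : Fin 2) :
    ∑ r : Fin 6, ∑ μ : Fin 2, liftGGR6s ε (orb p σ, orb r μ) (orb q τ, orb r μ) = 5 * liftGamR6s ε (orb p σ) (orb q τ) := by
  simp only [liftGGR6s_orb, liftGamR6s_orb]
  simp only [sum_family6]
  rw [Finset.mul_sum]
  refine Finset.sum_congr rfl fun j _ => ?_
  rw [l6sGG_contract j p σ q τ]
  push_cast
  ring

/-- `αα` block trace of the two-matrix family: `6 = 3·(3−1)`. -/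
theorem liftGGR6s_trace_upUp (ε : ℝ) :
    ∑ x : Fin 6, ∑ y : Fin 6, liftGGR6s ε (orb x 0, orb y 0) (orb x 0, orb y 0) = 6 := by
  simp only [liftGGR6s_orb]
  simp only [sum_family6]
  simp only [fun j => (l6sGG_blockTraces j).1, sum_weight_flag0, Rat.cast_ofNat]

/-- `ββ` block trace of the two-matrix family: `6`. -/
theorem liftGGR6s_trace_downDown (ε : ℝ) :
    ∑ x : Fin 6, ∑ y : Fin 6, liftGGR6s ε (orb x 1, orb y 1) (orb x 1, orb y 1) = 6 := by
  simp only [liftGGR6s_orb]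
  simp only [sum_family6]
  simp only [fun j => (l6sGG_blockTraces j).2.1, sum_weight_flag0, Rat.cast_ofNat]

/-- `αβ` block trace of the two-matrix family: `9 = 3·3`. -/
theorem liftGGR6s_trace_upDown (ε : ℝ) :
    ∑ x : Fin 6, ∑ y : Fin 6, liftGGR6s ε (orb x 0, orb y 1) (orb x 0, orb y 1) = 9 := by
  simp only [liftGGR6s_orb]
  simp only [sum_family6]
  simp only [fun j => (l6sGG_blockTraces j).2.2, sum_weight_flag0, Rat.cast_ofNat]

/-- The complex one-matrix family is Hermitian (real symmetric), for every `ε`. -/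
theorem liftGamC6s_isHermitian (ε : ℝ) : (liftGamC6s ε).IsHermitian := by
  have hs := (toLex (α := Fin 6 × Fin 2)).surjective
  refine Matrix.IsHermitian.ext fun i j => ?_
  obtain ⟨⟨p, σ⟩, rfl⟩ := hs i
  obtain ⟨⟨q, τ⟩, rfl⟩ := hs j
  show star (((liftGamR6s ε (orb q τ) (orb p σ) : ℝ) : ℂ)) = ((liftGamR6s ε (orb p σ) (orb q τ) : ℝ) : ℂ)
  rw [Complex.star_def, Complex.conj_ofReal, liftGamR6s_symm]

/-- The real two-matrix family is antisymmetric in the first pair. -/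
theorem liftGGR6s_swap_fst (ε : ℝ) (a b : Orb (Fin 6)) (R : Orb (Fin 6) × Orb (Fin 6)) :
    liftGGR6s ε (b, a) R = -liftGGR6s ε (a, b) R := by
  simp only [liftGGR6s, ← Finset.sum_neg_distrib]
  refine Finset.sum_congr rfl fun j _ => ?_
  rw [l6sGG_orb_swap_fst, Rat.cast_neg, mul_neg]

/-- The real two-matrix family is antisymmetric in the second pair. -/
theorem liftGGR6s_swap_snd (ε : ℝ) (P : Orb (Fin 6) × Orb (Fin 6)) (a b : Orb (Fin 6)) :
    liftGGR6s ε P (b, a) = -liftGGR6s ε P (a, b) := by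
  simp only [liftGGR6s, ← Finset.sum_neg_distrib]
  refine Finset.sum_congr rfl fun j _ => ?_
  rw [l6sGG_orb_swap_snd, Rat.cast_neg, mul_neg]

/-- The complex two-matrix family is antisymmetric in the first pair, for every `ε`. -/
theorem liftGGC6s_swap_fst (ε : ℝ) (i j : Orb (Fin 6)) (R : Orb (Fin 6) × Orb (Fin 6)) :
    liftGGC6s ε (j, i) R = -liftGGC6s ε (i, j) R := by
  show ((liftGGR6s ε (j, i) R : ℝ) : ℂ) = -((liftGGR6s ε (i, j) R : ℝ) : ℂ)
  rw [liftGGR6s_swap_fst, Complex.ofReal_neg]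

/-- The complex two-matrix family is antisymmetric in the second pair, for every `ε`. -/
theorem liftGGC6s_swap_snd (ε : ℝ) (P : Orb (Fin 6) × Orb (Fin 6)) (k l : Orb (Fin 6)) :
    liftGGC6s ε P (l, k) = -liftGGC6s ε P (k, l) := by
  show ((liftGGR6s ε P (l, k) : ℝ) : ℂ) = -((liftGGR6s ε P (k, l) : ℝ) : ℂ)
  rw [liftGGR6s_swap_snd, Complex.ofReal_neg]

/-- **THE ROWS.** For every `ε` the complex family satisfies every LINEAR row of `IsDQGFeasibleSector 3 3`; given the three
positivity conditions it is feasible. -/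
theorem isDQGFeasibleSector6s_of_psd3 (ε : ℝ) (hD : (liftGGC6s ε).PosSemidef)
    (hQ : (qMap (liftGamC6s ε) (liftGGC6s ε)).PosSemidef) (hG : (gMap (liftGamC6s ε) (liftGGC6s ε)).PosSemidef) :
    IsDQGFeasibleSector 3 3 (liftGamC6s ε) (liftGGC6s ε) := by
  have hs := (toLex (α := Fin 6 × Fin 2)).surjective
  have hγ : ∀ x y, liftGamC6s ε x y = ((liftGamR6s ε x y : ℝ) : ℂ) := fun _ _ => rfl
  have hΓ : ∀ P R, liftGGC6s ε P R = ((liftGGR6s ε P R : ℝ) : ℂ) := fun _ _ => rfl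
  refine ⟨⟨liftGamC6s_isHermitian ε, hD, hQ, hG, ?_, ?_, liftGGC6s_swap_fst ε, liftGGC6s_swap_snd ε⟩,
    ?_, ?_, ?_, ?_, ?_, ?_⟩
  · -- trace_one
    rw [sum_orb6]
    simp only [Fin.sum_univ_two, hγ, Finset.sum_add_distrib]
    rw [← Complex.ofReal_sum, ← Complex.ofReal_sum, liftGamR6s_trace_up, liftGamR6s_trace_down]
    norm_num
  · -- contraction
    intro i k
    obtain ⟨⟨p, σ⟩, rfl⟩ := hs i
    obtain ⟨⟨q, τ⟩, rfl⟩ := hs k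
    show ∑ j, liftGGC6s ε (orb p σ, j) (orb q τ, j) = (((3 + 3 : ℕ) : ℂ) - 1) * liftGamC6s ε (orb p σ) (orb q τ)
    rw [sum_orb6]
    simp only [hΓ, hγ]
    simp_rw [← Complex.ofReal_sum]
    rw [liftGGR6s_contract]
    push_cast
    ring
  · intro p q σ τ hστ
    rw [hγ, liftGamR6s_spin ε p q hστ, Complex.ofReal_zero]
  · simp only [hγ]
    rw [← Complex.ofReal_sum, liftGamR6s_trace_up]
    norm_num
  · simp only [hγ]
    rw [← Complex.ofReal_sum, liftGamR6s_trace_down]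
    norm_num
  · simp only [hΓ]
    simp_rw [← Complex.ofReal_sum]
    rw [liftGGR6s_trace_upUp]
    norm_num
  · simp only [hΓ]
    simp_rw [← Complex.ofReal_sum]
    rw [liftGGR6s_trace_downDown]
    norm_num
  · simp only [hΓ]
    simp_rw [← Complex.ofReal_sum]
    rw [liftGGR6s_trace_upDown]
    norm_num

/-- **THE L = 6 LIFT FAMILY IS `(3,3)`-SECTOR-DQG-FEASIBLE** for every `0 < ε ≤ 2⁻⁵¹` (`ε = 1/U`, i.e. for every
`U ≥ 2⁵¹`): layer 1's block certificates give `D, Q, G ⪰ 0`, §3 the linear rows. -/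
theorem lift6s_isDQGFeasibleSector {ε : ℝ} (hε0 : 0 < ε) (hε1 : ε ≤ 1 / 2 ^ 51) :
    IsDQGFeasibleSector 3 3 (liftGamC6s ε) (liftGGC6s ε) :=
  isDQGFeasibleSector6s_of_psd3 ε (liftGGC6s_posSemidef hε0 hε1) (qMap_liftC6s_posSemidef hε0 hε1)
    (gMap_liftC6s_posSemidef hε0 hε1)

/-! ## §4 The singlet row and singlet feasibility -/

/-- **The singlet row of the family**: `Σ_{x,y} Γˢ(ε)((x↑,y↓),(y↑,x↓)) = 3` (Mazziotti's `S`-representability row (98) at `S = M = 0`,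
`N = 6`), from the coefficientwise kernel row `l6sGG_exchange` by linearity. -/
theorem liftGGR6s_exchange (ε : ℝ) :
    ∑ x : Fin 6, ∑ y : Fin 6, liftGGR6s ε (orb x 0, orb y 1) (orb y 0, orb x 1) = 3 := by
  simp only [liftGGR6s_orb]
  simp only [sum_family6]
  simp only [l6sGG_exchange, sum_weight_flag0, Rat.cast_ofNat]

/-- **THE L = 6 SINGLET LIFT FAMILY IS SINGLET-DQG-FEASIBLE** (`IsDQGFeasibleSinglet 3`: the `(3,3)`-sector programme's rows and the
`S`-representability row (98)) for every `0 < ε ≤ 2⁻⁵¹` (`ε = 1/U`, i.e. for every `U ≥ 2⁵¹`). -/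
theorem lift6s_isDQGFeasibleSinglet {ε : ℝ} (hε0 : 0 < ε) (hε1 : ε ≤ 1 / 2 ^ 51) :
    IsDQGFeasibleSinglet 3 (liftGamC6s ε) (liftGGC6s ε) := by
  refine ⟨lift6s_isDQGFeasibleSector hε0 hε1, ?_⟩
  have hΓ : ∀ P R, liftGGC6s ε P R = ((liftGGR6s ε P R : ℝ) : ℂ) := fun _ _ => rfl
  simp only [hΓ]
  simp_rw [← Complex.ofReal_sum]
  rw [liftGGR6s_exchange]
  norm_num

end LiftL6

end Summit.Ventures.CertifiedQuantumChemistry
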